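import Summits.ResolutionOfSingularities.ResolutionOfSingularities.Theorems.FrobeniusLadderFRationalResolutionFixedPointLogRegular
import Summits.ResolutionOfSingularities.ResolutionOfSingularities.Theorems.FrobeniusLadderFRationalResolutionStabilizerSubgroup
import Summits.ResolutionOfSingularities.ResolutionOfSingularities.Theorems.FrobeniusLadderFRationalResolutionCoarsening
import HarnessLib

/-!
# Crux `FrobeniusLadder.FRationalResolution` (stmt-ResolutionOfSingularities-15317), line `redirect`,
# stub `stub_diagonalizableQuotientResolution` — at EVERY prime `𝔔` of `S` the intermediate quotient
# `Spec S^{(B_𝔔)}` (invariants of the stabiliser `D(A/B_𝔔)`) is KATO-LOG-REGULAR at the image of `𝔔`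

Corollary of the fixed-point milestone (`…FixedPointLogRegular`) and the coarsening
(`…StabilizerSubgroup`, `…Coarsening`): for `S` regular of finite type over a field graded by a
torsion group `A` and ANY prime `𝔔`, let `B = B_𝔔 ≤ A` be the degrees carrying a unit at `𝔔` and
grade `S` by `A/B` (`S'_c = ⨆_{[a]=c} S_a`); `𝔔` is a fixed prime for this grading, so the ring
`S' _0 = S^{(B)} = ⊕_{b ∈ B} S_b` (with `S₀ ⊆ S^{(B)} ⊆ S`, `Spec S → Spec S^{(B)} → Spec S₀` the
quotients by `D(A/B)` and then `D(B)`) has `Spec S^{(B)}` Kato-log-regular at `𝔔 ∩ S^{(B)}` for the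
monomial chart of a homogeneous regular system of parameters of `S_𝔔`.

* `exists_isLogRegularAt_intermediate` — the statement above (everything exhibited existentially:
  `B`, the coarsened grading, the parameters, the chart).

What is left between this and the stub (census): the descent `Spec S^{(B)} → Spec S₀` near `𝔮`
(a `D(B)`-torsor: free of rank `|B|` on homogeneous units; ÉTALE when `char k ∤ |B|`, giving an
étale log chart of `Spec S₀` at `𝔮`; the `p`-part of `B` is the open design point), the chart
normalisation (`P` finitely generated, `Pᵍᵖ ≅ ℤⁿ`) and the compatibility of charts on overlaps for
the tree's proved Nizioł/Kato resolution of log regular schemes. Honest label: corollary (no stub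
closed). No definitions, no named facts, no sorry. [cite: Kato1994, Def. (2.1)]
[folklore; cite: SGA3, Exp. VIII §4–5]
-/

noncomputable section

-- single-problem summit: the doubled namespace component is forced
set_option linter.dupNamespace false

open Literature.AlgebraicGeometry.Resolution

namespace Summit.ResolutionOfSingularities.ResolutionOfSingularities.Theorems.FRationalResolution.EveryPointLogRegular

universe u w

variable {k : Type u} [Field k] {A : Type w} [DecidableEq A] [AddCommGroup A] {S : Type u}
  [CommRing S] [Algebra k S] (𝒮 : A → Submodule k S) [GradedAlgebra 𝒮]

/-- **At every prime of `S`, the intermediate quotient by the stabiliser is Kato-log-regular.**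
`S` regular of finite type over a field, graded by a torsion abelian group `A`; `𝔔` any prime. With
`B = B_𝔔` (degrees carrying a unit at `𝔔`) and the coarsened grading `S'` of `S` by `A/B`
(`S'_c = ⨆_{[a] = c} S_a`, so `S'_0 = ⊕_{b∈B} S_b ⊇ S₀`): there are homogeneous `x₁,…,x_n ∈ 𝔔`,
`n = dim S_𝔔`, of `A/B`-degrees `aᵢ`, and the monomial chart
`P = {m ∈ ℤⁿ_{≥0} : Σ mᵢ aᵢ = 0} → S'_0`, `m ↦ x^m`, for which `Spec S'_0` satisfies Kato's (2.1) at
`𝔔 ∩ S'_0`. [cite: Kato1994, Def. (2.1)] -/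
theorem exists_isLogRegularAt_intermediate [IsRegularRing S] [Algebra.FiniteType k S]
    (hA : AddMonoid.IsTorsion A) (𝔔 : Ideal S) [𝔔.IsPrime] :
    ∃ (B : AddSubgroup A) (_ : DecidableEq (A ⧸ B)) (𝒮' : A ⧸ B → Submodule k S)
      (_ : GradedAlgebra 𝒮'),
      (∀ a : A, a ∈ B ↔ ∃ s ∈ 𝒮 a, s ∉ 𝔔) ∧
      (∀ c, 𝒮' c = ⨆ a ∈ {a : A | (a : A ⧸ B) = c}, 𝒮 a) ∧ (∀ a, 𝒮 a ≤ 𝒮' (a : A ⧸ B)) ∧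
      ∃ (n : ℕ) (x : Fin n → S) (a : Fin n → A ⧸ B),
        (∀ i, x i ∈ 𝔔 ∧ x i ∈ 𝒮' (a i)) ∧
        (n : WithBot ℕ∞) = ringKrullDim (Localization.AtPrime 𝔔) ∧
        ∃ φ : Multiplicative ↥(AddSubmonoid.nonneg (Fin n → ℤ) ⊓
            AddMonoidHom.mker (Fintype.linearCombination ℤ a).toAddMonoidHom) →* 𝒮' 0,
          (∀ p, ((φ (Multiplicative.ofAdd p) : 𝒮' 0) : S) =
            ∏ i, x i ^ ((p : Fin n → ℤ) i).toNat) ∧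
          LogChart.IsLogRegularAt _ φ (𝔔.comap (algebraMap (𝒮' 0) S)) := by
  classical
  obtain ⟨B, hB, -⟩ := StabilizerSubgroup.exists_unitDegrees_addSubgroup 𝒮 hA 𝔔
  obtain ⟨𝒮', inst, h𝒮', hle, hfix, hA'⟩ := Coarsening.exists_coarsening_fixed 𝒮 hA 𝔔 B hB
  obtain ⟨n, x, a, hxa, hn, φ, hφ, hlog⟩ :=
    FixedPointLogRegular.exists_isLogRegularAt_of_fixed 𝒮' hA' 𝔔 hfix
  exact ⟨B, inferInstance, 𝒮', inst, hB, h𝒮', hle, n, x, a, hxa, hn, φ, hφ, hlog⟩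

end Summit.ResolutionOfSingularities.ResolutionOfSingularities.Theorems.FRationalResolution.EveryPointLogRegular

end
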